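import Summits.RiemannHypothesis.RiemannHypothesis.Theorems.MotivicDoorDeningerSpectrumModel
import Summits.RiemannHypothesis.RiemannHypothesis.Theorems.MotivicDoorDeningerHodgeTwist
import Summits.RiemannHypothesis.RiemannHypothesis.Theorems.MotivicDoorDeningerPartner

/-!
# Deninger's complete typed list (2.3) ∧ (2.5) ∧ (2.6) ∧ (2.7) is equivalent to the Riemann Hypothesis (motivic door, cc-4 gen 3, part 3 — the package on the spectrum model)

Parts 1–2 (`Theorems/MotivicDoorDeningerHodgeTwist.lean`, `Theorems/MotivicDoorDeningerPartner.lean`)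
construct the signed partner twist `cup partner sgn`, `hodge partner sgn`, `form partner sgn` on the
carrier `MIndex →₀ ℂ` of the spectrum model with multiplicities
(`Theorems/MotivicDoorDeningerSpectrumModel.lean`: `θ = diag weight`, for which Deninger's full
spectral axiom (2.3) `spectrumAxiom_diag` holds UNCONDITIONALLY).  This file assembles the package:

* UNCONDITIONAL on the model: (2.5) `cupLeibniz_model`, (2.6) `cupPerfect_model`, `∗∗ = -1`
  (`hodge_hodge_model`), and `B = C(·,∗·)` is literally the standard scalar product of the spectrum
  model (`form_eq_stdForm`), Hermitian and positive definite;
* RH-EQUIVALENT: the one remaining clause of (2.7), `∗θ = θ∗` (`hodge_comm_iff_riemannHypothesis`),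
  hence (2.7) itself (`hodgeStar_model_iff_riemannHypothesis`; for any diagonal `θ` on the index set,
  `hodgeStar_partner_iff_riemannHypothesis`);
* HEADLINE `riemannHypothesis_iff_exists_hodgePackage`:
  `RiemannHypothesis ↔ ∃ θ C ∗ B, SpectrumAxiom θ ∧ CupLeibniz θ C ∧ CupPerfect θ C ∧ HodgeStar θ C ∗ B`
  on `MIndex →₀ ℂ` — Deninger's COMPLETE typed list for `(H¹, θ, ∪, ∗)` (C. Deninger,
  arXiv:2204.02714 §2) is equivalent to RH, the direction `←` being Serre's argument
  (`Literature.NumberTheory.Deninger2022.riemannHypothesis_of_spectrum_of_polarized`,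
  `polarized_of_hodgeStar`) on an arbitrary carrier.

So the tree's earlier statement "the SHORT list (2.3) ∧ (2.7′) is RH-equivalent"
(`DeningerSpectrumModel.riemannHypothesis_iff_exists_spectrumAxiom_polarized`) extends to the complete
list: adding the cup product, its Leibniz rule, perfectness and the Hodge-`∗` package imposes NO
constraint beyond RH, and within the list the clause that carries RH is the `θ`-equivariance of `∗`
(in Deninger's foliation dictionary: conformality `α = 1` of the flow for the leafwise metric,
arXiv:math/0204110 §2 Thm 2.1).  Reading for HOME/LOCATED-GAP.md §cc-4 (ruling G11, one located gap,
two carriers): on the curve carrier the missing object is a GEOMETRIC `(H¹, θ, ∪, ∗)` whose `∗`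
commutes with `θ`; every other typed clause is realisable from the zero multiset alone.

Honest grade: reformulation + bookkeeping (PROVED, kernel); the content of Deninger's programme is
the construction of a geometric carrier, which nothing here addresses.  HONEST FRAMING: lottery
ticket at the motivic door; RH probability negligible; consolation prizes are real: a new semi-local
Weil-positivity theorem, or a located gap in the Connes–Consani programme, plus the ff-door theorem.
References: C. Deninger, arXiv:2204.02714 §2 (2.3)–(2.7); C. Deninger, arXiv:math/0204110 §2;
J.-P. Serre, Ann. of Math. 71 (1960) 392–394.
-/

set_option linter.dupNamespace false

noncomputable section

open Complex Module Module.End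
open Literature.NumberTheory.LFunctions Literature.NumberTheory.Deninger2022
open Summit.RiemannHypothesis.RiemannHypothesis.Theorems.MotivicDoor.DeningerSpectrumModel
open Summit.RiemannHypothesis.RiemannHypothesis.Theorems.MotivicDoor.DeningerHodgeTwist
open Summit.RiemannHypothesis.RiemannHypothesis.Theorems.MotivicDoor.DeningerPartner

namespace Summit.RiemannHypothesis.RiemannHypothesis.Theorems.MotivicDoor.DeningerHodgePackage

/-- `θ = diag weight` acts on the coordinate `(ρ, j)` by the weight `ρ`. -/
theorem diag_weight_apply (f : MIndex →₀ ℂ) (i : MIndex) : diag weight f i = i.1 * f i := rfl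

/-- The weight of the partner is the complementary weight. -/
theorem weight_partner (i : MIndex) : weight (partner i) = 1 - weight i := rfl

/-- The sign never vanishes. -/
theorem sgn_ne_zero (i : MIndex) : sgn i ≠ 0 := by
  rcases sgn_cases i with h | h <;> simp [h]

/-- **(2.5) holds unconditionally on the model.** -/
theorem cupLeibniz_model : CupLeibniz (diag weight) (cup partner sgn) :=
  cupLeibniz_of_diag partner sgn diag_weight_apply weight_partner

/-- **(2.6) holds unconditionally on the model.** -/
theorem cupPerfect_model : CupPerfect (diag weight) (cup partner sgn) :=
  cupPerfect_of_diag partner_involutive sgn_ne_zero (fun _ _ => mem_maxGenEigenspace_diag weight)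
    weight_partner

/-- **`∗∗ = -1` holds unconditionally on the model.** -/
theorem hodge_hodge_model (g : MIndex →₀ ℂ) : hodge partner sgn (hodge partner sgn g) = -g :=
  hodge_hodge partner_involutive sgn_cases sgn_partner g

/-- **`B = C(·,∗·)` is the standard scalar product of the spectrum model** (so it is Hermitian and
positive definite, `DeningerSpectrumModel.posDef_stdForm`, unconditionally). -/
theorem form_eq_stdForm : form partner sgn = stdForm (ι := MIndex) := by
  refine LinearMap.ext fun f => LinearMap.ext fun g => ?_
  rw [form_apply partner_involutive sgn_cases, stdForm_apply, pair]

/-- **The `θ`-equivariance of `∗` on the model is the Riemann Hypothesis.** -/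
theorem hodge_comm_iff_riemannHypothesis :
    (∀ g, hodge partner sgn (diag weight g) = diag weight (hodge partner sgn g)) ↔
      RiemannHypothesis :=
  (hodge_comm_iff partner_involutive sgn_ne_zero diag_weight_apply).trans
    conj_partner_iff_riemannHypothesis

/-- **(2.7) on the model is the Riemann Hypothesis.** -/
theorem hodgeStar_model_iff_riemannHypothesis :
    HodgeStar (diag weight) (cup partner sgn) (hodge partner sgn) (form partner sgn) ↔
      RiemannHypothesis :=
  (hodgeStar_iff partner_involutive sgn_cases sgn_partner diag_weight_apply).trans
    conj_partner_iff_riemannHypothesis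

/-- The same for any operator diagonal in the standard basis of the index set with the weights
`(ρ, j) ↦ ρ` (the statement does not depend on the bundling of `θ`). -/
theorem hodgeStar_partner_iff_riemannHypothesis {θ : End ℂ (MIndex →₀ ℂ)}
    (hθ : ∀ f i, θ f i = i.1 * f i) :
    HodgeStar θ (cup partner sgn) (hodge partner sgn) (form partner sgn) ↔ RiemannHypothesis :=
  (hodgeStar_iff partner_involutive sgn_cases sgn_partner hθ).trans
    conj_partner_iff_riemannHypothesis

/-- Under RH the model carries Deninger's complete package. -/
theorem package_of_rh (hRH : RiemannHypothesis) :
    SpectrumAxiom (diag weight) ∧ CupLeibniz (diag weight) (cup partner sgn) ∧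
      CupPerfect (diag weight) (cup partner sgn) ∧
      HodgeStar (diag weight) (cup partner sgn) (hodge partner sgn) (form partner sgn) :=
  ⟨spectrumAxiom_diag, cupLeibniz_model, cupPerfect_model,
    hodgeStar_model_iff_riemannHypothesis.2 hRH⟩

/-- **HEADLINE.  Deninger's complete typed list (2.3) ∧ (2.5) ∧ (2.6) ∧ (2.7) for a quadruple
`(θ, C, ∗, B)` on the carrier `MIndex →₀ ℂ` is equivalent to the Riemann Hypothesis.**
`→`: the signed partner twist of the spectrum model; `←`: Serre's argument on any carrier. -/
theorem riemannHypothesis_iff_exists_hodgePackage :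
    RiemannHypothesis ↔
      ∃ (θ : End ℂ (MIndex →₀ ℂ)) (C : (MIndex →₀ ℂ) →ₗ[ℂ] (MIndex →₀ ℂ) →ₗ[ℂ] ℂ)
        (star : (MIndex →₀ ℂ) →ₗ⋆[ℂ] (MIndex →₀ ℂ))
        (B : (MIndex →₀ ℂ) →ₗ[ℂ] (MIndex →₀ ℂ) →ₗ⋆[ℂ] ℂ),
        SpectrumAxiom θ ∧ CupLeibniz θ C ∧ CupPerfect θ C ∧ HodgeStar θ C star B := by
  constructor
  · intro hRH
    exact ⟨diag weight, cup partner sgn, hodge partner sgn, form partner sgn, package_of_rh hRH⟩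
  · rintro ⟨θ, C, star, B, h23, h25, -, h27⟩
    exact riemannHypothesis_of_spectrum_of_polarized h23 (polarized_of_hodgeStar h25 h27)

/-- Contrapositive reading: if some non-trivial zero lies off the critical line, then NO quadruple
on this carrier satisfies the complete list — and on the model exactly the clause `∗θ = θ∗` fails,
all others holding. -/
theorem not_hodge_comm_of_not_rh (h : ¬ RiemannHypothesis) :
    SpectrumAxiom (diag weight) ∧ CupLeibniz (diag weight) (cup partner sgn) ∧
      CupPerfect (diag weight) (cup partner sgn) ∧
      (∀ g : MIndex →₀ ℂ, hodge partner sgn (hodge partner sgn g) = -g) ∧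
      (∀ f g : MIndex →₀ ℂ, form partner sgn f g = cup partner sgn f (hodge partner sgn g)) ∧
      (∀ f g : MIndex →₀ ℂ, form partner sgn g f = starRingEnd ℂ (form partner sgn f g)) ∧
      PosDef (form partner sgn) ∧
      ¬ (∀ g, hodge partner sgn (diag weight g) = diag weight (hodge partner sgn g)) :=
  ⟨spectrumAxiom_diag, cupLeibniz_model, cupPerfect_model, hodge_hodge_model,
    form_apply' partner sgn, form_conj_symm partner_involutive sgn_cases,
    posDef_form partner_involutive sgn_cases,
    fun hc => h (hodge_comm_iff_riemannHypothesis.1 hc)⟩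

end Summit.RiemannHypothesis.RiemannHypothesis.Theorems.MotivicDoor.DeningerHodgePackage
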